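import Literature.AlgebraicGeometry.AbelianSchemes.PELTupleSpreadStageOfStageDuals        -- ★ p848288: stage currency (`stageOver`, `baseDiagram`) + the consumer's `hdual` binder
import Literature.AlgebraicGeometry.AbelianSchemes.DualPairOfAmpleRigidifiedChartsGlue       -- ★ p848609: `MumfordDual.nonempty_dualPair_of_charts_of_letter`
import Literature.AlgebraicGeometry.AbelianSchemes.RankOneLocalEmbeddingSpreadDedekind       -- ★ p848056 (ε): projective affine charts off finitely many primes
import Literature.AlgebraicGeometry.AbelianSchemes.KOfLKilledOnFiniteAffineCharts            -- ★ p848097 (δ): one exponent killing `K(L)` on a finite char-0 cover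
import Literature.AlgebraicGeometry.AbelianSchemes.AbelianSchemeBaseChangeAlongLift          -- ★ `IsBaseChangeVia.exists_isBaseChangeVia_baseChange_along`
import Literature.AlgebraicGeometry.AbelianSchemes.DualPairTransportAlongIso                 -- ★ `DualPair.ofIso`
import Literature.AlgebraicGeometry.Modules.RankOneCocycle                                   -- ★ `exists_frameSystem_of_hasRank`
import Literature.AlgebraicGeometry.AbelianVarieties.LineBundleTensorPower                   -- ★ `hasRank_tensorPow_one`
import Mathlib.AlgebraicGeometry.Morphisms.UniversallyOpen                                  -- `Flat.generalizingMap`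
import HarnessLib

/-!
# The dual abelian scheme at a finer stage, from the letter `DualPairOfAmpleRigidified` and a rigidified rank-one `L` of ample fibre classes
# ([MumfordAV1970] §13 «the dual exists for projective `X∕S`»; [FaltingsChai1990] I §1; spread out by [EGAIV3] §8)

Layer `Literature/AlgebraicGeometry/AbelianSchemes`, namespace `Literature.AlgebraicGeometry.AbelianSchemes.AbelianSchemeOver`.  THEOREMS ONLY
(no definition, no named fact, no instance, no notation, no `sorry`); universe `Scheme.{0}` (that of the ★ stage organs).  Cell `hodgecm-mathlib`
(D-0151), P6 «MOD programme», L4 DUALS road, «DUALS-AT-STAGE» FILE 2 (LA4-plan (g0) DEAL #12, 2026-09-02; memo LA4-p05 (g0) 769746b7 steps 6–9):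
the payer side of the `hdual` binder of ★ `exists_stage_pelTuple_of_generic_of_stageDuals` (p848288) inside `stub_GSPREAD`, DISCHARGED from the
socket `stub_DUALS : DualPairOfAmpleRigidified` (the letter, passed as the hypothesis `hD`, 9 binders `R A hA L hL hε hΘ n hn hkill ⊢ Nonempty A.DualPair`)
once a rank-one `L` rigidified along the unit section with (symmetric) ample fibre classes is available on the stage family (FILE 1, LA4-p04 (g0):
steps 0–5, α ★ B10 → β ★ p848351 → η ★ p848375 → γ ★ p848139).  `--supports stmt-HodgeConjecture-24832`, count-neutral.  HONEST LABEL: HC_CM is proved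
only modulo the cell's printed citations (2 remaining named inputs: hLiu418 = stmt-HodgeConjecture-24832, h413 = stmt-HodgeConjecture-24833) until
rung 0 closes; this file is generic abelian-scheme geometry over a localisation tower and discharges neither.

THE MATHEMATICS.  `A` a Dedekind domain of characteristic `0`, `P → Spec A` flat, quasi-compact, locally of finite presentation, the STAGES
`P ⊗ D(s) = P ×_A Spec A[1∕s]` (`s ∈ A ∖ 0`, ★ `Limits/LocalizationDiagram`, `Limits/LocalizationRelativeGroupSpread`: `stageOver σ : P ⊗ D(s) → P ⊗ D(t)`
for `σ : s ⟶ t`, an AFFINE OPEN immersion) locally Noetherian.  Let `𝒜` be an abelian scheme over the stage `T = P ⊗ D(t)` and `L` a rank-one module on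
`𝒜` rigidified along the unit section (`hε`), of the class of an ample divisor at every geometric point (`hΘ`) and of the class of a SYMMETRIC ample
divisor at every geometric point of characteristic `0` (`hwit`).  THEN `𝒜 ×_T (P ⊗ D(s))` carries a dual pair for some `s ∣`-below `t`:

* (6) ε ★ `exists_opens_finite_image_compl_forall_affineOpen_isProjective_of_cechClass` (with `q := (P ⊗ D(t) → Spec A)`, `B := A`, a rank-one frame
  system of `L^{⊗3}` by ★ `exists_frameSystem_of_hasRank`): an open `𝒱 ⊆ T` containing the generic fibre, off which only FINITELY many primes of `A`
  lie, covered by Noetherian affine charts `e : Spec E ↪ 𝒱` with `𝒜 ×_T Spec E → Spec E` PROJECTIVE ([EGAIII1] (4.7.1), [MumfordAV1970] §16–17);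
* (7) SHRINK: each bad prime `𝔭 ≠ 0` contains some `b_𝔭 ≠ 0`; at the stage `s₃ := t · ∏ b_𝔭` every point of `P ⊗ D(s₃)` maps to a prime `∌ s₃`
  (`Scheme.Hom.opensRange_localizationAway`), hence into `𝒱`; finitely many ε-charts `e_j : Spec E_j ↪ T` then cover the image of the quasi-compact
  `P ⊗ D(s₃)`, and each `E_j` has characteristic `0` — it is flat over `A` with a point, so has a point over the generic point (Mathlib
  `Flat.generalizingMap`) whose residue field has characteristic `0` (★ `charZero_residueField_of_apply_eq_bot`);
* (8) δ ★ `exists_nat_forall_chart_pow_eq_one_of_memKOfL` AT THE STAGE `t`, on that finite char-`0` family: ONE `d ≥ 1` killing `K(G^*L)` on every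
  base change `G` of an `𝒜 ×_T Spec E_j` along any `Spec E_j ← Spec R′` with `d ∈ R′^×` ([MumfordAV1970] §13 «`K(L) ⊆ X[n]`»); `d ∈ A[1∕s]^×` for `s`
  below some `m_d` (★ `exists_idx_forall_isUnit_algebraMap_loc`); the final stage `s := min (s₃, m_d)`;
* (9) the final charts of `P ⊗ D(s)` are the pull-backs `Spec R_j = Spec E_j ×_T (P ⊗ D(s))` of the ε-charts (affine: the transition is affine;
  Noetherian; `d ∈ R_j^×` since `R_j` is an `A[1∕s]`-algebra); over each, `(𝒜 ×_T (P ⊗ D(s))) ×_{P⊗D(s)} Spec R_j` is the base change of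
  `𝒜 ×_T Spec E_j` along `Spec R_j → Spec E_j` AS GROUP SCHEMES (★ `IsBaseChangeVia.exists_isBaseChangeVia_baseChange_along`), so it is projective
  (★ `IsProjective.of_isPullback`), the pulled-back `L` is rigidified (★ `IsBaseChangeVia.pullback_unitSection_detClass_pullback_eq_one`) of ample fibre
  classes (§1 `IsBaseChangeVia.exists_isAmple_cechClass_fibre_pullback`), and `K` of it is `d`-torsion (δ verbatim): the letter `hD` applies chart by
  chart and the chart duals GLUE (★ `MumfordDual.nonempty_dualPair_of_charts_of_letter`, [BoschLutkebohmertRaynaud1990] §8.1 Prop. 4).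

* §1 three bookkeeping lemmas: `charZero_of_flat_of_point`, `val_notMem_asIdeal_stage`, `IsBaseChangeVia.exists_isAmple_cechClass_fibre_pullback`.
* §2 **`exists_stage_nonempty_dualPair_of_letter`** — the statement above (FILE 2 head; `hΘ`∕`hwit` are δ's and ε's binder texts verbatim).
* §3 `nonempty_dualPair_baseChange_of_baseChange_baseChange` (a dual pair of `(A ×_S S′) ×_{S′} S″` is one of `A ×_S S″`, ★ `DualPair.ofIso` along
  ★ `exists_iso_of_isBaseChangeVia_id`) and the RE-BASED reading **`exists_stage_nonempty_dualPair_of_letter_of_stage`**: data on `𝒜ₜ ×_{P⊗D(t)} (P ⊗ D(s₂))`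
  (`ρ : s₂ ⟶ t`, the output currency of FILE 1) ⇒ `∃ s (σ : s ⟶ t), Nonempty (𝒜ₜ.baseChange (stageOver σ).hom).DualPair` — the conclusion of the
  `hdual` binder of ★ p848288 token for token.

## References
* [MumfordAV1970] D. Mumford, *Abelian Varieties* (1970), §13 (pp. 123–125: `K(L)`, the dual exists for projective `X`), §16–§17.
* [MumfordFogartyKirwan1994] D. Mumford, J. Fogarty, F. Kirwan, *Geometric Invariant Theory*, 3rd ed. (1994), Ch. 6 §1 Cor. 6.8 (p. 118), Ch. 7 §2
  Definition 7.2 (p. 129).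
* [FaltingsChai1990] G. Faltings, C.-L. Chai, *Degeneration of Abelian Varieties* (1990), Ch. I §1 (Thm. 1.9: the dual abelian scheme).
* [BoschLutkebohmertRaynaud1990] S. Bosch, W. Lütkebohmert, M. Raynaud, *Néron Models* (1990), §8.1 Prop. 4 (pp. 204–205).
* [EGAIV3] A. Grothendieck, J. Dieudonné, *EGA IV₃* (1966), Thm. 8.8.2, Thm. 8.10.5 (iii), (xiii).
* [EGAIII1] A. Grothendieck, J. Dieudonné, *EGA III₁* (1961), Thm. (4.7.1) (p. 145).
* [GortzWedhorn2020] U. Görtz, T. Wedhorn, *Algebraic Geometry I*, 2nd ed. (2020), §(10.13) (pp. 261–262), Prop. 4.16 (p. 101), Section (4.7)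
  (pp. 107–108), Prop. 14.3 and Lemma 14.9 (flat ⇒ generalizing).
* [StacksProject] The Stacks Project, Tags 01YT, 01ZC, 00FE, 03HV.
-/

set_option autoImplicit false

noncomputable section

set_option backward.isDefEq.respectTransparency false

open CategoryTheory CategoryTheory.Limits AlgebraicGeometry MonoidalCategory CartesianMonoidalCategory
open scoped MonObj
open Literature.AlgebraicGeometry.Limits Literature.AlgebraicGeometry.Limits.LocApprox
open Literature.AlgebraicGeometry.Motives Literature.AlgebraicGeometry.Modules Literature.AlgebraicGeometry.Morphisms
open Literature.AlgebraicGeometry.AbelianVarieties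

namespace Literature.AlgebraicGeometry.AbelianSchemes

namespace AbelianSchemeOver

/-! ## §1 Three bookkeeping lemmas -/

section Lemmas

/-- **A ring flat over a domain of characteristic `0`, with a point, has characteristic `0`.**  Flat morphisms are generalizing (Mathlib
`Flat.generalizingMap`, [GortzWedhorn2020] Lemma 14.9), so `Spec E` has a point `y` over the generic point of `Spec B`; its residue field has
characteristic `0` (★ `charZero_residueField_of_apply_eq_bot`) and receives a ring map from `E` (evaluation at `y`), whence `CharZero E`
(`RingHom.charZero`). [cite: GortzWedhorn2020, Lemma 14.9 (p. 432) and Prop. 14.3] [cite: StacksProject, Tag 03HV] -/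
theorem charZero_of_flat_of_point {B : Type} [CommRing B] [IsDomain B] [CharZero B] {E : Type} [CommRing E]
    (f : Spec (.of E) ⟶ Spec (.of B)) [Flat f] (y₀ : Spec (.of E)) : CharZero E := by
  have hgen : (⟨⊥, Ideal.isPrime_bot⟩ : PrimeSpectrum B) ⤳ f y₀ := (PrimeSpectrum.le_iff_specializes _ _).mp bot_le
  obtain ⟨y, -, hy⟩ := Flat.generalizingMap f hgen
  have hbot : (f y).asIdeal = ⊥ := by rw [hy]
  haveI := charZero_residueField_of_apply_eq_bot f y hbot
  exact ((Scheme.ΓSpecIso (.of E)).inv ≫ (Spec (.of E)).evaluation ⊤ y (Set.mem_univ y)).hom.charZero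

/-- **Points of the stage `P ⊗ D(t)` lie over primes not containing `t`**: the structure map `P ⊗ D(t) → Spec A` factors through the open
immersion `D(t) = Spec A[1∕t] ↪ Spec A`, whose range is the basic open `D(t)` (Mathlib `Scheme.Hom.opensRange_localizationAway`).
[cite: GortzWedhorn2020, §(10.13) (pp. 261–262)] [cite: StacksProject, Tag 01YT] -/
theorem val_notMem_asIdeal_stage {A : Type} [CommRing A] (P : SchemeOver A) (t : Idx (nonZeroDivisors A))
    (x : (P ⊗ (baseDiagram (nonZeroDivisors A)).obj t).left) :
    t.val ∉ ((P ⊗ (baseDiagram (nonZeroDivisors A)).obj t).hom x).asIdeal := by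
  have h1 : (P ⊗ (baseDiagram (nonZeroDivisors A)).obj t).hom x =
      ((baseDiagram (nonZeroDivisors A)).obj t).hom ((CartesianMonoidalCategory.snd P ((baseDiagram (nonZeroDivisors A)).obj t)).left x) := by
    rw [← Scheme.Hom.comp_apply, Over.w]
  have h2 : ((baseDiagram (nonZeroDivisors A)).obj t).hom ((CartesianMonoidalCategory.snd P ((baseDiagram (nonZeroDivisors A)).obj t)).left x) ∈
      (Spec.map (CommRingCat.ofHom (algebraMap (CommRingCat.of A) (Localization.Away t.val)))).opensRange := ⟨_, rfl⟩
  rw [Scheme.Hom.opensRange_localizationAway (R := CommRingCat.of A) t.val] at h2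
  rw [h1]
  exact (PrimeSpectrum.mem_basicOpen _ _).mp h2

/-- **Ample fibre classes survive pull-back along a base change of group schemes** (the `IsBaseChangeVia` form of ★
`exists_isAmple_cechClass_fibre_baseChange`): if `G : A′ → A` exhibits `A′∕S′` as the base change of `A∕S` along `g` and the rank-one `L` on `A` has,
at every geometric point `s` of `S`, fibre class `[L|_{A_s}] = [Θ]` with `Θ` ample, then `G^*L` has ample fibre classes at every geometric point `s′`
of `S′`: through the fibre isomorphism `e : A′_{s′} ≅ A_{s′ ≫ g}` over `G` (★ `IsBaseChangeVia.exists_fibreIso`), `[G^*L|_{A′_{s′}}] = [e^*Θ]`, and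
ampleness pulls back along isomorphisms. [cite: MumfordFogartyKirwan1994, Ch. 6 §2 Definition 6.2 (p. 120) and Ch. 7 §2 Definition 7.2 (p. 129)]
[cite: GortzWedhorn2020, Section (4.7) (pp. 107–108) and Prop. 4.16 (p. 101)] -/
theorem IsBaseChangeVia.exists_isAmple_cechClass_fibre_pullback {S S' : Scheme.{0}} {A' : AbelianSchemeOver S'} {A : AbelianSchemeOver S}
    {g : S' ⟶ S} {G : A'.X.left ⟶ A.X.left} (h : A'.IsBaseChangeVia A g G) {L : A.left.Modules} (hL : HasRank L 1)
    (hΘ : ∀ ⦃Ω : Type⦄ [Field Ω] [IsAlgClosed Ω] (s : Spec (.of Ω) ⟶ S),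
      ∃ Θ : CartierDivisor (A.fibre s).toAbelianVariety.X.left, Θ.IsAmple ∧
        CechPic.pullback (X := (A.fibre s).toAbelianVariety.X.left) (pullback.fst A.X.hom s)
          (detClass (HasRank.isFiniteLocallyFree' hL)) = Θ.cechClass)
    ⦃Ω : Type⦄ [Field Ω] [IsAlgClosed Ω] (s' : Spec (.of Ω) ⟶ S') :
    ∃ Θ' : CartierDivisor (A'.fibre s').toAbelianVariety.X.left, Θ'.IsAmple ∧
      CechPic.pullback (X := (A'.fibre s').toAbelianVariety.X.left) (pullback.fst A'.X.hom s')
        (detClass (HasRank.isFiniteLocallyFree' (hasRank_pullback G hL))) = Θ'.cechClass := by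
  obtain ⟨Θ, hamp, hc⟩ := hΘ (s' ≫ g)
  obtain ⟨e, he⟩ := h.exists_fibreIso s'
  haveI : IsIso (AbelianVariety.Hom.toSchemeHom e.hom) :=
    ⟨AbelianVariety.Hom.toSchemeHom e.inv, by
      change AbelianVariety.Hom.toSchemeHom (e.hom ≫ e.inv) = _; rw [e.hom_inv_id]; rfl, by
      change AbelianVariety.Hom.toSchemeHom (e.inv ≫ e.hom) = _; rw [e.inv_hom_id]; rfl⟩
  haveI := AbelianVariety.isDominant_toSchemeHom_iso_hom e
  refine ⟨Θ.pullback (AbelianVariety.Hom.toSchemeHom e.hom), hamp.pullback _, ?_⟩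
  rw [CartierDivisor.cechClass_pullback, ← hc, detClass_pullback _ (HasRank.isFiniteLocallyFree' hL), ← CechPic.pullback_comp,
    ← CechPic.pullback_comp, he]

/-- **A dual pair of the iterated base change `(A ×_S S′) ×_{S′} S″` is a dual pair of `A ×_S S″`** (along any `f = g′ ≫ g`): both are base changes
of `A` along `f` as group schemes (★ `baseChange_isBaseChangeVia`, ★ `IsBaseChangeVia.trans`), hence isomorphic as `S″`-group schemes over the
projections (★ `IsBaseChangeVia.exists_isBaseChangeVia_id`, ★ `exists_iso_of_isBaseChangeVia_id`), and dual pairs move along such isomorphisms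
(★ `DualPair.ofIso`). [cite: MumfordFogartyKirwan1994, Ch. 7 §2 Definition 7.2 (p. 129) and Definition 7.3 (p. 130)]
[cite: GortzWedhorn2020, Prop. 4.16 (p. 101) and Section (4.7) (pp. 107–108)] [cite: MilneAV2008, I §8 pp. 36–37] -/
theorem nonempty_dualPair_baseChange_of_baseChange_baseChange {S S' S'' : Scheme.{0}} (A : AbelianSchemeOver S) (g : S' ⟶ S) (g' : S'' ⟶ S')
    {f : S'' ⟶ S} (hf : g' ≫ g = f) (D : ((A.baseChange g).baseChange g').DualPair) : Nonempty (A.baseChange f).DualPair := by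
  have h₁ : ((A.baseChange g).baseChange g').IsBaseChangeVia A f (pullback.fst (A.baseChange g).X.hom g' ≫ pullback.fst A.X.hom g) :=
    IsBaseChangeVia.congr_base hf (((A.baseChange g).baseChange_isBaseChangeVia g').trans (A.baseChange_isBaseChangeVia g))
  obtain ⟨H, -, -, hH⟩ := IsBaseChangeVia.exists_isBaseChangeVia_id (A.baseChange_isBaseChangeVia f) h₁
  obtain ⟨e, -, he⟩ := exists_iso_of_isBaseChangeVia_id hH
  haveI := he
  exact ⟨D.ofIso e⟩

end Lemmas

/-! ## §2 The dual pair at a finer stage, from the letter -/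

section Charts

variable {A : Type} [CommRing A] [IsDedekindDomain A] [CharZero A]
  {P : SchemeOver A} [QuasiCompact P.hom] [LocallyOfFinitePresentation P.hom] [Flat P.hom]
  [∀ s : Idx (nonZeroDivisors A), IsLocallyNoetherian (P ⊗ (baseDiagram (nonZeroDivisors A)).obj s).left]

/-- **THE DUAL PAIR AT A FINER STAGE, FROM THE LETTER `DualPairOfAmpleRigidified`** («DUALS-AT-STAGE» steps 6–9).  `A` Dedekind of characteristic
`0`; `P → Spec A` flat, quasi-compact, locally of finite presentation, with locally Noetherian stages `P ⊗ D(s)`; `𝒜` an abelian scheme over the stage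
`P ⊗ D(t)`; `L` rank one on `𝒜`, rigidified along the unit section (`hε`), of ample fibre class at EVERY geometric point (`hΘ`, the binder of δ ★
`exists_nat_forall_chart_pow_eq_one_of_memKOfL`) and of SYMMETRIC ample fibre class at every characteristic-`0` geometric point (`hwit`, the binder of
ε ★ `exists_opens_finite_image_compl_forall_affineOpen_isProjective_of_cechClass`); `hD` the letter (9 binders, = the socket `stub_DUALS`).  THEN for some
`σ : s ⟶ t` the restriction `𝒜 ×_{P⊗D(t)} (P ⊗ D(s))` has a dual pair: ε-charts → shrink past the finitely many bad primes → δ at the stage `t` on the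
finite char-`0` family of ε-charts → invert `d` → pull the charts back to the final stage (one `IsBaseChangeVia` step per chart) → the letter chart by
chart → glue (★ `MumfordDual.nonempty_dualPair_of_charts_of_letter`).  See the module docstring for the step-by-step account.
[cite: MumfordAV1970, §13 (pp. 123–125)] [cite: MumfordFogartyKirwan1994, Ch. 6 §1 Cor. 6.8 (p. 118)] [cite: FaltingsChai1990, Ch. I §1 Thm. 1.9]
[cite: BoschLutkebohmertRaynaud1990, §8.1 Prop. 4 (pp. 204–205)] [cite: EGAIV3, Thm. 8.10.5 (xiii) and Thm. 8.8.2] [cite: EGAIII1, Thm. (4.7.1) p. 145]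
[cite: GortzWedhorn2020, §(10.13) (pp. 261–262) and Prop. 4.16 (p. 101)] -/
theorem exists_stage_nonempty_dualPair_of_letter
    (hD : ∀ (R : Type) [CommRing R] [IsNoetherianRing R] (A : AbelianSchemeOver (Spec (.of R)))
      (_hA : IsProjective A.X.hom) (L : A.left.Modules) (hL : HasRank L 1),
      CechPic.pullback A.unitSection (detClass (HasRank.isFiniteLocallyFree' hL)) = 1 →
      (∀ ⦃Ω : Type⦄ [Field Ω] [IsAlgClosed Ω] (s : Spec (.of Ω) ⟶ Spec (.of R)),
        ∃ Θ : CartierDivisor (A.fibre s).toAbelianVariety.X.left, Θ.IsAmple ∧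
          CechPic.pullback (X := (A.fibre s).toAbelianVariety.X.left) (pullback.fst A.X.hom s)
            (detClass (HasRank.isFiniteLocallyFree' hL)) = Θ.cechClass) →
      ∀ (n : ℕ), IsUnit ((n : ℕ) : R) →
        (∀ (T : Over (Spec (.of R))) (u : T ⟶ A.X), A.MemKOfL L u → u ^ n = 1) →
        Nonempty A.DualPair)
    (t : Idx (nonZeroDivisors A)) (𝒜 : AbelianSchemeOver (P ⊗ (baseDiagram (nonZeroDivisors A)).obj t).left)
    (L : 𝒜.left.Modules) (hL : HasRank L 1)
    (hε : CechPic.pullback 𝒜.unitSection (detClass (HasRank.isFiniteLocallyFree' hL)) = 1)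
    (hΘ : ∀ ⦃Ω : Type⦄ [Field Ω] [IsAlgClosed Ω] (z : Spec (.of Ω) ⟶ (P ⊗ (baseDiagram (nonZeroDivisors A)).obj t).left),
      ∃ Θ : CartierDivisor (𝒜.fibre z).toAbelianVariety.X.left, Θ.IsAmple ∧
        CechPic.pullback (X := (𝒜.fibre z).toAbelianVariety.X.left) (pullback.fst 𝒜.X.hom z)
          (detClass (HasRank.isFiniteLocallyFree' hL)) = Θ.cechClass)
    (hwit : ∀ ⦃Ω : Type⦄ [Field Ω] [IsAlgClosed Ω] [CharZero Ω] (z : Spec (.of Ω) ⟶ (P ⊗ (baseDiagram (nonZeroDivisors A)).obj t).left),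
      ∃ Θ : CartierDivisor (𝒜.fibre z).toAbelianVariety.X.left, Θ.IsAmple ∧
        (Θ.pullback (AbelianVariety.Hom.toSchemeHom (-𝟙 (𝒜.fibre z).toAbelianVariety))).LinEquiv Θ ∧
        CechPic.pullback (X := (𝒜.fibre z).toAbelianVariety.X.left) (pullback.fst 𝒜.X.hom z)
          (detClass (HasRank.isFiniteLocallyFree' hL)) = Θ.cechClass) :
    ∃ (s : Idx (nonZeroDivisors A)) (σ : s ⟶ t), Nonempty (𝒜.baseChange (stageOver (nonZeroDivisors A) P σ).hom).DualPair := by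
  classical
  -- instances on the stages `P ⊗ D(r)`: Noetherian, flat and locally of finite type over `Spec A`
  have hcpt : ∀ r : Idx (nonZeroDivisors A), CompactSpace (P ⊗ (baseDiagram (nonZeroDivisors A)).obj r).left := fun r =>
    QuasiCompact.compactSpace_of_compactSpace (pullback.snd P.hom ((baseDiagram (nonZeroDivisors A)).obj r).hom)
  haveI : ∀ r : Idx (nonZeroDivisors A), IsNoetherian (P ⊗ (baseDiagram (nonZeroDivisors A)).obj r).left := fun r =>
    haveI := hcpt r; {}
  have hflat : ∀ r : Idx (nonZeroDivisors A), Flat (P ⊗ (baseDiagram (nonZeroDivisors A)).obj r).hom := fun r => by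
    rw [Over.tensorObj_hom]; infer_instance
  haveI : LocallyOfFiniteType (P ⊗ (baseDiagram (nonZeroDivisors A)).obj t).hom := by
    rw [Over.tensorObj_hom]; infer_instance
  -- (6) ε: projective affine charts off finitely many primes of `A`
  obtain ⟨F, hF⟩ := exists_frameSystem_of_hasRank (hasRank_tensorPow_one hL 3)
  obtain ⟨𝒱, hfin, hgen, hchart⟩ :=
    𝒜.exists_opens_finite_image_compl_forall_affineOpen_isProjective_of_cechClass (P ⊗ (baseDiagram (nonZeroDivisors A)).obj t).hom L hL F hF hwit
  -- (7) SHRINK past the bad primes: they are nonzero, so contain nonzero elements; invert their product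
  have hb : ∀ 𝔭 ∈ (P ⊗ (baseDiagram (nonZeroDivisors A)).obj t).hom '' ((𝒱 : Set _)ᶜ), ∃ b : A, b ∈ 𝔭.asIdeal ∧ b ≠ 0 := by
    rintro _ ⟨x, hx, rfl⟩
    exact Submodule.exists_mem_ne_zero_of_ne_bot fun h => hx (hgen x h)
  choose! b hbmem hbne using hb
  have ha : t.val * ∏ 𝔭 ∈ hfin.toFinset, b 𝔭 ∈ nonZeroDivisors A :=
    mul_mem t.mem (prod_mem fun 𝔭 h𝔭 => mem_nonZeroDivisors_of_ne_zero (hbne 𝔭 (hfin.mem_toFinset.mp h𝔭)))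
  let s₃ : Idx (nonZeroDivisors A) := ⟨_, ha⟩
  let ρ₃ : s₃ ⟶ t := homOfLE (Idx.le_iff.mpr (dvd_mul_right t.val _))
  -- every point of `P ⊗ D(s₃)` maps into `𝒱`
  have hin : ∀ x : (P ⊗ (baseDiagram (nonZeroDivisors A)).obj s₃).left, (stageOver (nonZeroDivisors A) P ρ₃).hom x ∈ 𝒱 := by
    intro x
    by_contra hx
    have hmem : (P ⊗ (baseDiagram (nonZeroDivisors A)).obj t).hom ((stageOver (nonZeroDivisors A) P ρ₃).hom x) ∈
        (P ⊗ (baseDiagram (nonZeroDivisors A)).obj t).hom '' ((𝒱 : Set _)ᶜ) := ⟨_, hx, rfl⟩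
    have hq : (P ⊗ (baseDiagram (nonZeroDivisors A)).obj t).hom ((stageOver (nonZeroDivisors A) P ρ₃).hom x) =
        (P ⊗ (baseDiagram (nonZeroDivisors A)).obj s₃).hom x := by
      have hw : (stageOver (nonZeroDivisors A) P ρ₃).hom ≫ (P ⊗ (baseDiagram (nonZeroDivisors A)).obj t).hom =
          (P ⊗ (baseDiagram (nonZeroDivisors A)).obj s₃).hom := Over.w (P ◁ (baseDiagram (nonZeroDivisors A)).map ρ₃)
      rw [← hw, Scheme.Hom.comp_apply]
      rfl
    obtain ⟨c, hc⟩ := (Finset.dvd_prod_of_mem b (hfin.mem_toFinset.mpr hmem)).trans (dvd_mul_left _ t.val)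
    apply val_notMem_asIdeal_stage P s₃ x
    rw [← hq]
    change t.val * ∏ 𝔭 ∈ hfin.toFinset, b 𝔭 ∈ _
    rw [hc]
    exact Ideal.mul_mem_right _ _ (hbmem _ hmem)
  -- the ε-charts through the points of `P ⊗ D(s₃)`
  have hch : ∀ x : (P ⊗ (baseDiagram (nonZeroDivisors A)).obj s₃).left, ∃ (E : Type) (_ : CommRing E) (_ : IsNoetherianRing E)
      (e : Spec (.of E) ⟶ (P ⊗ (baseDiagram (nonZeroDivisors A)).obj t).left) (_ : IsOpenImmersion e),
      (stageOver (nonZeroDivisors A) P ρ₃).hom x ∈ Set.range e ∧ IsProjective (pullback.snd 𝒜.X.hom e) := by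
    intro x
    obtain ⟨E, _, _, e, _, hxe, -, hproj⟩ := hchart _ (hin x)
    exact ⟨E, ‹_›, ‹_›, e, ‹_›, hxe, hproj⟩
  choose E instE instEN e inste hxe hproje using hch
  -- a finite subcover of `P ⊗ D(s₃)`
  obtain ⟨J, hJ⟩ := (isCompact_univ (X := (P ⊗ (baseDiagram (nonZeroDivisors A)).obj s₃).left)).elim_finite_subcover
    (fun x => (((stageOver (nonZeroDivisors A) P ρ₃).hom ⁻¹ᵁ (e x).opensRange : 
      (P ⊗ (baseDiagram (nonZeroDivisors A)).obj s₃).left.Opens) : Set (P ⊗ (baseDiagram (nonZeroDivisors A)).obj s₃).left))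
    (fun x => ((stageOver (nonZeroDivisors A) P ρ₃).hom ⁻¹ᵁ (e x).opensRange).isOpen)
    (fun x _ => Set.mem_iUnion.mpr ⟨x, hxe x⟩)
  -- the chart rings have characteristic `0` (flat over `A` with a point)
  have hchar : ∀ x, CharZero (E x) := fun x => by
    obtain ⟨y₀, -⟩ := hxe x
    haveI := hflat t
    haveI : Flat (e x ≫ (P ⊗ (baseDiagram (nonZeroDivisors A)).obj t).hom) := inferInstance
    exact charZero_of_flat_of_point (e x ≫ (P ⊗ (baseDiagram (nonZeroDivisors A)).obj t).hom) y₀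
  -- (8) δ at the stage `t` with the finite family of charts indexed by `J`: one exponent `d`
  haveI : ∀ j : J, CharZero (E j.1) := fun j => hchar j.1
  obtain ⟨d, hd, hkill⟩ := 𝒜.exists_nat_forall_chart_pow_eq_one_of_memKOfL hL hε hΘ (fun j : J => E j.1) (fun j : J => e j.1)
  -- `d` is a unit below some stage `m`; the final stage `s ≤ s₃, m`
  have hdK : IsUnit ((d : ℕ) : FractionRing A) := by
    rw [isUnit_iff_ne_zero, ← map_natCast (algebraMap A (FractionRing A)), map_ne_zero_iff _ (IsFractionRing.injective A (FractionRing A))]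
    exact Nat.cast_ne_zero.mpr hd.ne'
  obtain ⟨m, hm⟩ := exists_idx_forall_isUnit_algebraMap_loc (S := nonZeroDivisors A) (B := FractionRing A) d hdK
  obtain ⟨s, σ₄, ⟨τ⟩⟩ : ∃ (s : Idx (nonZeroDivisors A)) (_ : s ⟶ s₃), Nonempty (s ⟶ m) :=
    ⟨_, IsCofiltered.minToLeft s₃ m, ⟨IsCofiltered.minToRight s₃ m⟩⟩
  have hds : IsUnit ((d : ℕ) : loc (nonZeroDivisors A) s) := by
    have h := hm s (leOfHom τ); rwa [map_natCast] at h
  refine ⟨s, σ₄ ≫ ρ₃, ?_⟩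
  -- the composite transition and its factorisation through `P ⊗ D(s₃)`
  have hgσ : (stageOver (nonZeroDivisors A) P (σ₄ ≫ ρ₃)).hom =
      (P ◁ (baseDiagram (nonZeroDivisors A)).map σ₄).left ≫ (stageOver (nonZeroDivisors A) P ρ₃).hom :=
    (whiskerLeft_map_left_comp_whiskerLeft_map_left (nonZeroDivisors A) P σ₄ ρ₃).symm
  haveI : IsAffineHom (stageOver (nonZeroDivisors A) P (σ₄ ≫ ρ₃)).hom := by
    change IsAffineHom (P ◁ _).left; infer_instance
  haveI : IsLocallyNoetherian (stageOver (nonZeroDivisors A) P (σ₄ ≫ ρ₃)).left :=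
    inferInstanceAs (IsLocallyNoetherian (P ⊗ (baseDiagram (nonZeroDivisors A)).obj s).left)
  -- (9) the final charts: pull the ε-charts back along the (affine, open) transition `P ⊗ D(s) → P ⊗ D(t)`
  let Q : J → Scheme.{0} := fun j => pullback (e j.1) (stageOver (nonZeroDivisors A) P (σ₄ ≫ ρ₃)).hom
  haveI hQaff : ∀ j, IsAffine (Q j) := fun j =>
    haveI : IsAffineHom (pullback.fst (e j.1) (stageOver (nonZeroDivisors A) P (σ₄ ≫ ρ₃)).hom) :=
      MorphismProperty.pullback_fst _ _ inferInstance
    isAffine_of_isAffineHom (pullback.fst (e j.1) (stageOver (nonZeroDivisors A) P (σ₄ ≫ ρ₃)).hom)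
  let R : J → Type := fun j => Γ(Q j, ⊤)
  let c : ∀ j, Spec (.of (R j)) ⟶ (P ⊗ (baseDiagram (nonZeroDivisors A)).obj s).left := fun j =>
    (Q j).isoSpec.inv ≫ pullback.snd (e j.1) (stageOver (nonZeroDivisors A) P (σ₄ ≫ ρ₃)).hom
  let κ : ∀ j, Spec (.of (R j)) ⟶ Spec (.of (E j.1)) := fun j =>
    (Q j).isoSpec.inv ≫ pullback.fst (e j.1) (stageOver (nonZeroDivisors A) P (σ₄ ≫ ρ₃)).hom
  have hcκ : ∀ j, Spec.map (Spec.preimage (κ j)) ≫ e j.1 = c j ≫ (stageOver (nonZeroDivisors A) P (σ₄ ≫ ρ₃)).hom := fun j => by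
    rw [Spec.map_preimage]
    change ((Q j).isoSpec.inv ≫ pullback.fst _ _) ≫ e j.1 = ((Q j).isoSpec.inv ≫ pullback.snd _ _) ≫ _
    rw [Category.assoc, Category.assoc, pullback.condition]
  haveI hcopen : ∀ j, IsOpenImmersion (c j) := fun j => inferInstance
  haveI hRN : ∀ j, IsNoetherianRing (R j) := fun j =>
    haveI : IsLocallyNoetherian (Q j) :=
      isLocallyNoetherian_of_isOpenImmersion (pullback.snd (e j.1) (stageOver (nonZeroDivisors A) P (σ₄ ≫ ρ₃)).hom)
    IsLocallyNoetherian.component_noetherian ⟨⊤, isAffineOpen_top (Q j)⟩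
  -- the charts cover `P ⊗ D(s)`
  have hcov : ∀ z : (P ⊗ (baseDiagram (nonZeroDivisors A)).obj s).left, ∃ j, z ∈ Set.range (c j) := by
    intro z
    obtain ⟨x, hxJ, hz⟩ := Set.mem_iUnion₂.mp (hJ (Set.mem_univ ((P ◁ (baseDiagram (nonZeroDivisors A)).map σ₄).left z)))
    refine ⟨⟨x, hxJ⟩, ?_⟩
    have hz' : z ∈ Set.range (pullback.snd (e x) (stageOver (nonZeroDivisors A) P (σ₄ ≫ ρ₃)).hom) := by
      rw [Scheme.Pullback.range_snd, Set.mem_preimage, hgσ, Scheme.Hom.comp_apply]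
      exact hz
    obtain ⟨w, rfl⟩ := hz'
    refine ⟨(Q ⟨x, hxJ⟩).isoSpec.hom w, ?_⟩
    change ((Q ⟨x, hxJ⟩).isoSpec.hom ≫ (Q ⟨x, hxJ⟩).isoSpec.inv ≫ pullback.snd (e x) _) w = _
    rw [Iso.hom_inv_id_assoc]
  -- `d` is a unit in every chart ring (they are `A[1∕s]`-algebras)
  have hunit : ∀ j, IsUnit ((d : ℕ) : R j) := fun j => by
    have h := hds.map (Spec.preimage (c j ≫ (CartesianMonoidalCategory.snd P ((baseDiagram (nonZeroDivisors A)).obj s)).left)).hom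
    rwa [map_natCast] at h
  -- per chart: the pull-back relation to the ε-chart family at the stage `t`, along `κ j = Spec (φ j)`
  have hrel : ∀ j, ∃ mj : ((𝒜.baseChange (stageOver (nonZeroDivisors A) P (σ₄ ≫ ρ₃)).hom).baseChange (c j)).X.left ⟶ (𝒜.baseChange (e j.1)).X.left,
      ((𝒜.baseChange (stageOver (nonZeroDivisors A) P (σ₄ ≫ ρ₃)).hom).baseChange (c j)).IsBaseChangeVia (𝒜.baseChange (e j.1))
        (Spec.map (CommRingCat.ofHom (Spec.preimage (κ j)).hom)) mj := fun j => by
    obtain ⟨mj, hmj, -⟩ := (𝒜.baseChange_isBaseChangeVia (stageOver (nonZeroDivisors A) P (σ₄ ≫ ρ₃)).hom).exists_isBaseChangeVia_baseChange_along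
      (e j.1) (c j) (Spec.map (Spec.preimage (κ j))) (hcκ j)
    exact ⟨mj, hmj⟩
  choose mj hmj using hrel
  -- glue the letter over the charts
  refine MumfordDual.nonempty_dualPair_of_charts_of_letter hD (𝒜.baseChange (stageOver (nonZeroDivisors A) P (σ₄ ≫ ρ₃)).hom) R c hcov
    (fun j => ?_) (fun j => (Scheme.Modules.pullback (mj j)).obj ((Scheme.Modules.pullback (pullback.fst 𝒜.X.hom (e j.1))).obj L))
    (fun j => hasRank_pullback (mj j) (hasRank_pullback _ hL))
    (fun j => (hmj j).pullback_unitSection_detClass_pullback_eq_one (hasRank_pullback _ hL)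
      (𝒜.pullback_unitSection_detClass_baseChange_eq_one (e j.1) hL hε))
    (fun j Ω _ _ z => (hmj j).exists_isAmple_cechClass_fibre_pullback (hasRank_pullback _ hL)
      (𝒜.exists_isAmple_cechClass_fibre_baseChange hL hΘ (e j.1) (hasRank_pullback _ hL)) z)
    (fun _ => d) hunit (fun j T u hu => hkill j (R j) (Spec.preimage (κ j)).hom (hunit j) _ (mj j) (hmj j) T u hu)
  -- projectivity of the chart families: base change of the projective `𝒜 ×_T Spec (E j)` along `κ j`
  obtain ⟨-, hpb, -, -⟩ := hmj j
  exact IsProjective.of_isPullback hpb (hproje j.1)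

/-! ## §3 The re-based reading: data on `𝒜ₜ ×_{P⊗D(t)} (P ⊗ D(s₂))`, dual pair on `𝒜ₜ ×_{P⊗D(t)} (P ⊗ D(s))` -/

/-- **«DUALS-AT-STAGE», RE-BASED** (the form the HEAD `stageDuals_of_letter` consumes after FILE 1): for an abelian scheme `𝒜ₜ` over the stage `P ⊗ D(t)`,
a refinement `ρ : s₂ ⟶ t` and a rank-one `L` on the restriction `𝒜ₜ ×_{P⊗D(t)} (P ⊗ D(s₂))` with the three fibre-class data `hε`, `hΘ`, `hwit` (the
output currency of FILE 1: α ★ B10 → β ★ p848351 → η ★ p848375 → γ ★ p848139), SOME restriction `𝒜ₜ ×_{P⊗D(t)} (P ⊗ D(s))` (`σ : s ⟶ t`) carries a dual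
pair — §2 at the stage `s₂`, then §1 `nonempty_dualPair_baseChange_of_baseChange_baseChange` along `stageOver σ′ ≫ stageOver ρ = stageOver (σ′ ≫ ρ)`
(★ `whiskerLeft_map_left_comp_whiskerLeft_map_left`).  The conclusion is the `hdual` binder of ★ `exists_stage_pelTuple_of_generic_of_stageDuals`
token for token. [cite: MumfordAV1970, §13 (pp. 123–125)] [cite: MumfordFogartyKirwan1994, Ch. 6 §1 Cor. 6.8 (p. 118) and Ch. 7 §2 Definition 7.3 (p. 130)]
[cite: EGAIV3, Thm. 8.10.5 (xiii) and Thm. 8.8.2] [cite: GortzWedhorn2020, §(10.13) (pp. 261–262)] -/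
theorem exists_stage_nonempty_dualPair_of_letter_of_stage
    (hD : ∀ (R : Type) [CommRing R] [IsNoetherianRing R] (A : AbelianSchemeOver (Spec (.of R)))
      (_hA : IsProjective A.X.hom) (L : A.left.Modules) (hL : HasRank L 1),
      CechPic.pullback A.unitSection (detClass (HasRank.isFiniteLocallyFree' hL)) = 1 →
      (∀ ⦃Ω : Type⦄ [Field Ω] [IsAlgClosed Ω] (s : Spec (.of Ω) ⟶ Spec (.of R)),
        ∃ Θ : CartierDivisor (A.fibre s).toAbelianVariety.X.left, Θ.IsAmple ∧
          CechPic.pullback (X := (A.fibre s).toAbelianVariety.X.left) (pullback.fst A.X.hom s)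
            (detClass (HasRank.isFiniteLocallyFree' hL)) = Θ.cechClass) →
      ∀ (n : ℕ), IsUnit ((n : ℕ) : R) →
        (∀ (T : Over (Spec (.of R))) (u : T ⟶ A.X), A.MemKOfL L u → u ^ n = 1) →
        Nonempty A.DualPair)
    {t : Idx (nonZeroDivisors A)} (𝒜ₜ : AbelianSchemeOver (P ⊗ (baseDiagram (nonZeroDivisors A)).obj t).left)
    {s₂ : Idx (nonZeroDivisors A)} (ρ : s₂ ⟶ t)
    (L : (𝒜ₜ.baseChange (stageOver (nonZeroDivisors A) P ρ).hom).left.Modules) (hL : HasRank L 1)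
    (hε : CechPic.pullback (𝒜ₜ.baseChange (stageOver (nonZeroDivisors A) P ρ).hom).unitSection (detClass (HasRank.isFiniteLocallyFree' hL)) = 1)
    (hΘ : ∀ ⦃Ω : Type⦄ [Field Ω] [IsAlgClosed Ω] (z : Spec (.of Ω) ⟶ (P ⊗ (baseDiagram (nonZeroDivisors A)).obj s₂).left),
      ∃ Θ : CartierDivisor ((𝒜ₜ.baseChange (stageOver (nonZeroDivisors A) P ρ).hom).fibre z).toAbelianVariety.X.left, Θ.IsAmple ∧
        CechPic.pullback (X := ((𝒜ₜ.baseChange (stageOver (nonZeroDivisors A) P ρ).hom).fibre z).toAbelianVariety.X.left)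
          (pullback.fst (𝒜ₜ.baseChange (stageOver (nonZeroDivisors A) P ρ).hom).X.hom z)
          (detClass (HasRank.isFiniteLocallyFree' hL)) = Θ.cechClass)
    (hwit : ∀ ⦃Ω : Type⦄ [Field Ω] [IsAlgClosed Ω] [CharZero Ω] (z : Spec (.of Ω) ⟶ (P ⊗ (baseDiagram (nonZeroDivisors A)).obj s₂).left),
      ∃ Θ : CartierDivisor ((𝒜ₜ.baseChange (stageOver (nonZeroDivisors A) P ρ).hom).fibre z).toAbelianVariety.X.left, Θ.IsAmple ∧
        (Θ.pullback (AbelianVariety.Hom.toSchemeHom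
          (-𝟙 ((𝒜ₜ.baseChange (stageOver (nonZeroDivisors A) P ρ).hom).fibre z).toAbelianVariety))).LinEquiv Θ ∧
        CechPic.pullback (X := ((𝒜ₜ.baseChange (stageOver (nonZeroDivisors A) P ρ).hom).fibre z).toAbelianVariety.X.left)
          (pullback.fst (𝒜ₜ.baseChange (stageOver (nonZeroDivisors A) P ρ).hom).X.hom z)
          (detClass (HasRank.isFiniteLocallyFree' hL)) = Θ.cechClass) :
    ∃ (s : Idx (nonZeroDivisors A)) (σ : s ⟶ t), Nonempty (𝒜ₜ.baseChange (stageOver (nonZeroDivisors A) P σ).hom).DualPair := by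
  obtain ⟨s, σ', ⟨D'⟩⟩ := exists_stage_nonempty_dualPair_of_letter hD s₂ (𝒜ₜ.baseChange (stageOver (nonZeroDivisors A) P ρ).hom) L hL hε hΘ hwit
  exact ⟨s, σ' ≫ ρ, nonempty_dualPair_baseChange_of_baseChange_baseChange 𝒜ₜ _ _
    (whiskerLeft_map_left_comp_whiskerLeft_map_left (nonZeroDivisors A) P σ' ρ) D'⟩

end Charts

end AbelianSchemeOver

end Literature.AlgebraicGeometry.AbelianSchemes

end
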